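import Summits.Ventures.PercRepro.C025ProfileThinGirthD
import Summits.Ventures.PercRepro.C025ProfileThinGirthArith5
import Summits.Ventures.PercRepro.C025ProfileThinTriangleE

/-!
# THE ROW `(q, q+1)` ON THIN MATROIDS WITH A 5-CIRCUIT: THE THEOREM FOR `g = 5` (night-3 g15; generated by lab/gen_thm.py)
**THEOREM (thin + 5-circuit)** `profileIneq_thinFive` / `hallIneq_thinFive` / `profileIneq_thinFive_indep`: for every `q ≥ 9` and every
finite matroid of girth `≥ 5` (every set of `≤ 4` points has full rank) with a 5-circuit `C₀` (`|C₀| = 5`, `ρ(C₀) + 1 = 5`) in which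
every rank-`q` set has at most `q + 1` points, the row `(q, q+1)` of C-032 and its Hall form (C-033) hold — for EVERY `n`: the general
theorem `profileIneq_thinGirth_of_weights` (part D) with `g = 5`, the closed-form weights of `C025ProfileThinGirthArith5` (`g5_weights`)
and the uniform inner payment `σ = 4/(3f)` when `f = n − q − 1 ≥ q`; the zero certificate (`ThinTriangle.profileIneq_of_small`) when `f < q`.
(Cap)(iii): `c (q + 2 − c) ≤ 4 (q − 2)` for `c ≤ 4`, so the load is `≤ 4 + 4·4(q − 2)/(3f) ≤ 4 + 16/3 ≤ q + 1` for `q ≥ 9`.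
-/
open scoped Matroid
namespace PercRepro
open Set Finset ThmH Staged
namespace ThinGirth
variable {α : Type} [DecidableEq α] {M : Matroid α} [M.Finite]

/-- **THEOREM (thin + 5-circuit)**: `q ≥ 9`, girth `≥ 5`, a 5-circuit `K`, every rank-`q` set with `≤ q + 1` points ⇒ the row
`(q, q+1)` of (Π) and its Hall form, for EVERY `n`. -/
theorem profileIneq_thinFive (q : ℕ) (hq : 9 ≤ q)
    (hgirth : ∀ X ⊆ gr M, X.card + 1 ≤ 5 → rkN M X = X.card)
    (hthin : ∀ X ⊆ gr M, rkN M X = q → X.card ≤ q + 1)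
    (K : Finset α) (hKg : K ⊆ gr M) (hKc : K.card = 5) (hKrk : rkN M K + 1 = 5) :
    Profile.ProfileIneq M q (q + 1) ∧ Profile.HallIneq M q (q + 1) := by
  rcases Nat.lt_or_ge ((gr M).card - q - 1) q with hlt | hge
  · exact ThinTriangle.profileIneq_of_small q hlt
  · have hw := g5_weights (q := q) (f := (gr M).card - q - 1) hq hge
    dsimp only at hw
    set f : ℚ := (((gr M).card - q - 1 : ℕ) : ℚ) with hfdef
    set sQ : ℚ := (4 : ℚ) / (5 * ((q : ℚ) - 3)) with hsQdef
    set a1 : ℚ := ((-6 : ℚ) + (-38/5 : ℚ) * f + (11 : ℚ) * f ^ 2 + (-6 : ℚ) * f ^ 3 + (1 : ℚ) * f ^ 4 + (11 : ℚ) * (q:ℚ) + (12/5 : ℚ) * (q:ℚ) * f + (-6 : ℚ) * (q:ℚ) ^ 2 + (-4/5 : ℚ) * (q:ℚ) ^ 2 * f + (1 : ℚ) * (q:ℚ) ^ 3) / (f * (f - 1) * (f - 2) * (f - 3)) with ha1def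
    set a2 : ℚ := ((3 : ℚ) + (14/5 : ℚ) * f + (-3 : ℚ) * f ^ 2 + (1 : ℚ) * f ^ 3 + (-5/2 : ℚ) * (q:ℚ) + (-2/5 : ℚ) * (q:ℚ) * f + (1/2 : ℚ) * (q:ℚ) ^ 2) / (f * (f - 1) * (f - 2)) with ha2def
    set a3 : ℚ := ((-3/2 : ℚ) + (-7/5 : ℚ) * f + (1 : ℚ) * f ^ 2 + (1/2 : ℚ) * (q:ℚ)) / (f * (f - 1)) with ha3def
    set a4 : ℚ := ((-3 : ℚ) + (-19/5 : ℚ) * f + (1 : ℚ) * (q:ℚ) + (1 : ℚ) * (q:ℚ) * f) / (f * ((q : ℚ) - 3)) with ha4def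
    set b0 : ℚ := ((-6 : ℚ) * f + (11 : ℚ) * f ^ 2 + (-6 : ℚ) * f ^ 3 + (1 : ℚ) * f ^ 4 + (6 : ℚ) * (q:ℚ) + (8/5 : ℚ) * (q:ℚ) * f + (-11 : ℚ) * (q:ℚ) ^ 2 + (-12/5 : ℚ) * (q:ℚ) ^ 2 * f + (6 : ℚ) * (q:ℚ) ^ 3 + (4/5 : ℚ) * (q:ℚ) ^ 3 * f + (-1 : ℚ) * (q:ℚ) ^ 4) / (f * (f - 1) * (f - 2) * (f - 3)) with hb0def
    set b1 : ℚ := ((3/2 : ℚ) + (12/5 : ℚ) * f + (-3 : ℚ) * f ^ 2 + (1 : ℚ) * f ^ 3 + (-11/4 : ℚ) * (q:ℚ) + (-3/5 : ℚ) * (q:ℚ) * f + (3/2 : ℚ) * (q:ℚ) ^ 2 + (1/5 : ℚ) * (q:ℚ) ^ 2 * f + (-1/4 : ℚ) * (q:ℚ) ^ 3) / (f * (f - 1) * (f - 2)) with hb1def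
    set b2 : ℚ := ((-1 : ℚ) + (-19/15 : ℚ) * f + (1 : ℚ) * f ^ 2 + (5/6 : ℚ) * (q:ℚ) + (2/15 : ℚ) * (q:ℚ) * f + (-1/6 : ℚ) * (q:ℚ) ^ 2) / (f * (f - 1)) with hb2def
    set b3 : ℚ := ((3/4 : ℚ) + (6/5 : ℚ) * f + (-1/4 : ℚ) * (q:ℚ)) / (f) with hb3def
    obtain ⟨⟨ha1, ha2, ha3, ha4, hb0, hb1, hb2, hb3, hsQ⟩, ⟨ha1', ha2', ha3', ha4', hb0', hb1', hb2', hb3'⟩, ⟨hkey, hd1, hd2, hd3, hdtop⟩, ⟨hc1, hc2, hc3, hc4, hcQ⟩⟩ := hw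
    clear_value sQ a1 a2 a3 a4 b0 b1 b2 b3
    have hfpos : (0 : ℚ) < f := by rw [hfdef]; exact_mod_cast (by omega : 0 < (gr M).card - q - 1)
    have hqf : (q : ℚ) ≤ f := by rw [hfdef]; exact_mod_cast hge
    have hq0' : (9 : ℚ) ≤ q := by exact_mod_cast hq
    have hσ43 : f * (4 / (3 * f)) = 4 / 3 := by field_simp
    let a : ℕ → ℚ := fun t => if t = 0 then 1 else if t = 1 then a1 else if t = 2 then a2 else if t = 3 then a3 else a4
    let b : ℕ → ℚ := fun t => if t = 0 then b0 else if t = 1 then b1 else if t = 2 then b2 else b3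
    have ea0 : a 0 = 1 := by simp [a]
    have ea1 : a 1 = a1 := by simp [a]
    have ea2 : a 2 = a2 := by simp [a]
    have ea3 : a 3 = a3 := by simp [a]
    have ea4 : a 4 = a4 := by simp [a]
    have eb0 : b 0 = b0 := by simp [b]
    have eb1 : b 1 = b1 := by simp [b]
    have eb2 : b 2 = b2 := by simp [b]
    have eb3 : b 3 = b3 := by simp [b]
    have hfcast1 : (((gr M).card - q - 5 + 1 : ℕ) : ℚ) = f - 3 := by
      have e : (gr M).card - q - 5 + 1 = (gr M).card - q - 1 - 3 := by omega
      rw [e, Nat.cast_sub (by omega), hfdef]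
      push_cast
      ring
    have hfcast2 : (((gr M).card - q - 5 + 2 : ℕ) : ℚ) = f - 2 := by
      have e : (gr M).card - q - 5 + 2 = (gr M).card - q - 1 - 2 := by omega
      rw [e, Nat.cast_sub (by omega), hfdef]
      push_cast
      ring
    have hfcast3 : (((gr M).card - q - 5 + 3 : ℕ) : ℚ) = f - 1 := by
      have e : (gr M).card - q - 5 + 3 = (gr M).card - q - 1 - 1 := by omega
      rw [e, Nat.cast_sub (by omega), hfdef]
      push_cast
      ring
    have hfcast0 : (((gr M).card - q - 5 : ℕ) : ℚ) = f - 4 := by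
      have e : (gr M).card - q - 5 = (gr M).card - q - 1 - 4 := by omega
      rw [e, Nat.cast_sub (by omega), hfdef]
      push_cast
      ring
    refine profileIneq_thinGirth_of_weights q 5 (by norm_num) (by omega) hgirth hthin K hKg hKc hKrk a b sQ
      (4 / (3 * f)) ?_ ?_ hsQ (by positivity) hge ?_ ?_ ?_ ?_ ?_ ?_ ?_
    · intro t
      simp only [a]
      split_ifs <;> first | assumption | norm_num
    · intro t
      simp only [b]
      split_ifs <;> assumption
    · -- (Dem) for the types `1 … 3`
      intro t ht1 ht2
      rcases (by omega : t = 1 ∨ t = 2 ∨ t = 3) with rfl | rfl | rfl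
      · rw [eb1, ea1, hfcast1]
        norm_num
        linarith only [hd1]
      · rw [eb2, ea2, hfcast2]
        norm_num
        linarith only [hd2]
      · rw [eb3, ea3, hfcast3]
        norm_num
        linarith only [hd3]
    · -- (Dem) for the type `0`: the KEY
      rw [eb0, ea0, hfcast0]
      norm_num
      linarith only [hkey]
    · -- the top demand
      rw [show (5 : ℕ) - 1 = 4 by rfl, ea4]
      exact le_of_eq hdtop.symm
    · -- `a t, b t ≤ f σ = 4/3` for `t ≤ 3`
      intro t ht
      rw [hσ43]
      rcases (by omega : t = 0 ∨ t = 1 ∨ t = 2 ∨ t = 3) with rfl | rfl | rfl | rfl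
      · rw [ea0, eb0]; exact ⟨by norm_num, hb0'⟩
      · rw [ea1, eb1]; exact ⟨ha1', hb1'⟩
      · rw [ea2, eb2]; exact ⟨ha2', hb2'⟩
      · rw [ea3, eb3]; exact ⟨ha3', hb3'⟩
    · -- (Cap) at `s = 0 … 4`
      intro s hs
      rcases (by omega : s = 0 ∨ s = 1 ∨ s = 2 ∨ s = 3 ∨ s = 4) with rfl | rfl | rfl | rfl | rfl
      · rw [ea0]
        norm_num
      · have e : ((q + 1 - 1 : ℕ) : ℚ) = q := by rw [Nat.add_sub_cancel]
        rw [show (1 : ℕ) - 1 = 0 by rfl, eb0, ea1, e]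
        norm_num
        linarith only [hc1]
      · have e : ((q + 1 - 2 : ℕ) : ℚ) = (q : ℚ) - 1 := by
          rw [show q + 1 - 2 = q - 1 by omega, Nat.cast_sub (by omega)]
          push_cast
          ring
        rw [show (2 : ℕ) - 1 = 1 by rfl, eb1, ea2, e]
        norm_num
        linarith only [hc2]
      · have e : ((q + 1 - 3 : ℕ) : ℚ) = (q : ℚ) - 2 := by
          rw [show q + 1 - 3 = q - 2 by omega, Nat.cast_sub (by omega)]
          push_cast
          ring
        rw [show (3 : ℕ) - 1 = 2 by rfl, eb2, ea3, e]
        norm_num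
        linarith only [hc3]
      · have e : ((q + 1 - 4 : ℕ) : ℚ) = (q : ℚ) - 3 := by
          rw [show q + 1 - 4 = q - 3 by omega, Nat.cast_sub (by omega)]
          push_cast
          ring
        rw [show (4 : ℕ) - 1 = 3 by rfl, eb3, ea4, e]
        norm_num
        linarith only [hc4]
    · -- the `Q'`-capacity
      have e1 : ((q + 2 - 5 : ℕ) : ℚ) = (q : ℚ) - 3 := by
        rw [show q + 2 - 5 = q - 3 by omega, Nat.cast_sub (by omega)]
        push_cast
        ring
      have e2 : ((5 * (q + 2 - 5) : ℕ) : ℚ) = 5 * ((q : ℚ) - 3) := by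
        rw [Nat.cast_mul, e1]
        norm_num
      rw [e1, e2]
      linarith only [hcQ]
    · -- (Cap) (iii): `c + c (q + 2 − c) σ ≤ q + 1` for `c ≤ 4`
      intro c hc
      have h1 : c * (q + 2 - c) ≤ 4 * (q - 2) := by
        rcases (by omega : c = 0 ∨ c = 1 ∨ c = 2 ∨ c = 3 ∨ c = 4) with rfl | rfl | rfl | rfl | rfl <;> omega
      have h1' : ((c * (q + 2 - c) : ℕ) : ℚ) ≤ 4 * ((q : ℚ) - 2) := by
        have h1c : ((c * (q + 2 - c) : ℕ) : ℚ) ≤ ((4 * (q - 2) : ℕ) : ℚ) := by exact_mod_cast h1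
        have e : ((4 * (q - 2) : ℕ) : ℚ) = 4 * ((q : ℚ) - 2) := by
          rw [Nat.cast_mul, Nat.cast_sub (by omega)]
          push_cast
          ring
        rw [e] at h1c
        exact h1c
      have h3 : ((q : ℚ) - 2) / f ≤ 1 := by
        rw [div_le_one hfpos]
        linarith
      have h2 : ((c * (q + 2 - c) : ℕ) : ℚ) * (4 / (3 * f)) ≤ 4 * 4 / 3 := by
        have hσpos : (0 : ℚ) ≤ 4 / (3 * f) := by positivity
        calc ((c * (q + 2 - c) : ℕ) : ℚ) * (4 / (3 * f))
            ≤ 4 * ((q : ℚ) - 2) * (4 / (3 * f)) := mul_le_mul_of_nonneg_right h1' hσpos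
          _ = 4 * 4 / 3 * (((q : ℚ) - 2) / f) := by field_simp
          _ ≤ 4 * 4 / 3 * 1 := mul_le_mul_of_nonneg_left h3 (by norm_num)
          _ = 4 * 4 / 3 := by norm_num
      have hc' : (c : ℚ) ≤ 4 := by exact_mod_cast (by omega : c ≤ 4)
      linarith only [h2, hc', hq0']

/-- THEOREM (thin + 5-circuit), the row alone. -/
theorem profileIneq_thinFive' (q : ℕ) (hq : 9 ≤ q)
    (hgirth : ∀ X ⊆ gr M, X.card + 1 ≤ 5 → rkN M X = X.card)
    (hthin : ∀ X ⊆ gr M, rkN M X = q → X.card ≤ q + 1)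
    (K : Finset α) (hKg : K ⊆ gr M) (hKc : K.card = 5) (hKrk : rkN M K + 1 = 5) :
    Profile.ProfileIneq M q (q + 1) :=
  (profileIneq_thinFive q hq hgirth hthin K hKg hKc hKrk).1

/-- THEOREM (thin + 5-circuit), the Hall form (C-033). -/
theorem hallIneq_thinFive (q : ℕ) (hq : 9 ≤ q)
    (hgirth : ∀ X ⊆ gr M, X.card + 1 ≤ 5 → rkN M X = X.card)
    (hthin : ∀ X ⊆ gr M, rkN M X = q → X.card ≤ q + 1)
    (K : Finset α) (hKg : K ⊆ gr M) (hKc : K.card = 5) (hKrk : rkN M K + 1 = 5) :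
    Profile.HallIneq M q (q + 1) :=
  (profileIneq_thinFive q hq hgirth hthin K hKg hKc hKrk).2

/-- **THEOREM (thin + 5-circuit), independence form**: `q ≥ 9`, every set of `≤ 4` points independent, `K ⊆ E` a dependent 5-set,
every rank-`q` set with `≤ q + 1` points ⇒ the row `(q, q+1)` of (Π) and its Hall form. -/
theorem profileIneq_thinFive_indep (q : ℕ) (hq : 9 ≤ q)
    (hgirth : ∀ T ⊆ M.E, T.encard ≤ 4 → M.Indep T)
    (hthin : ∀ X ⊆ gr M, rkN M X = q → X.card ≤ q + 1)
    (K : Finset α) (hKE : (K : Set α) ⊆ M.E) (hKc : K.card = 5) (hKdep : ¬ M.Indep (K : Set α)) :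
    Profile.ProfileIneq M q (q + 1) ∧ Profile.HallIneq M q (q + 1) := by
  have hKg : K ⊆ gr M := by
    intro k hk
    have : k ∈ ((gr M : Finset α) : Set α) := by rw [coe_gr]; exact hKE hk
    exact_mod_cast this
  have hgirth' : ∀ X ⊆ gr M, X.card + 1 ≤ 5 → rkN M X = X.card := by
    intro X hXg hXc
    have hXE : (X : Set α) ⊆ M.E := by rw [← coe_gr]; exact_mod_cast hXg
    apply OneCircuit.rkN_eq_card_of_indep
    apply hgirth _ hXE
    rw [Set.encard_coe_eq_coe_finsetCard]
    exact_mod_cast (by omega : X.card ≤ 4)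
  have hKrk : rkN M K + 1 = 5 := by
    have hle : rkN M K ≤ 4 := by
      by_contra h
      push Not at h
      have hg : rkN M K = 5 := le_antisymm (hKc ▸ rkN_le_card K) (by omega)
      apply hKdep
      rw [Matroid.indep_iff_eRk_eq_encard_of_finite K.finite_toSet, Set.encard_coe_eq_coe_finsetCard, hKc,
        ← rkN_eq_iff, hg]
    obtain ⟨k, hk⟩ : K.Nonempty := Finset.card_pos.mp (by omega)
    have hKk : rkN M (K.erase k) = (K.erase k).card :=
      hgirth' _ ((Finset.erase_subset k K).trans hKg) (by rw [Finset.card_erase_of_mem hk]; omega)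
    have hmono : rkN M (K.erase k) ≤ rkN M K := rkN_mono (Finset.erase_subset k K)
    rw [Finset.card_erase_of_mem hk, hKc] at hKk
    omega
  exact profileIneq_thinFive q hq hgirth' hthin K hKg hKc hKrk

end ThinGirth
end PercRepro
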